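import Literature.AlgebraicGeometry.Resolution.ApproximationCoefficient
import Literature.AlgebraicGeometry.Resolution.ApproximationDegreeCompose
import Literature.AlgebraicGeometry.Resolution.NewtonStepDominant
import Literature.AlgebraicGeometry.Resolution.KrasnerHenselian
import Literature.AlgebraicGeometry.Resolution.HenselizationImmediateProofs
import Literature.AlgebraicGeometry.Resolution.HenselizationHenselian
import Literature.AlgebraicGeometry.Resolution.Kuhlmann2019Lemma41
import HarnessLib

/-!
# Relative approximation degree one generates the henselization (Kuhlmann–Vlahu 2014, Prop. 10.5, `𝐡 = 1`)

Topic: `Literature/AlgebraicGeometry/Resolution` (valued function fields). F.-V. Kuhlmann,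
I. Vlahu, *The relative approximation degree in valued function fields*, Math. Z. 276 (2014) =
arXiv:1304.0200:

> **Proposition 10.5.** Assume (10.1). If `K(x)^h|K(y)^h` is separable, then
> `[K(x)^h : K(y)^h] ≤ 𝐡_K(x:y)`.
> **Corollary 10.8.** … `K(x)^h = K(y)^h ⟺ 𝐡_K(x:y) = 1`.

This file PROVES Prop. 10.5 (hence Cor. 10.8 "⇐") in relative approximation degree `𝐡 = 1`:
if `y ∈ K(x)^h` admits a good approximant `f₀(x)` of relative approximation degree `1`
(`exists_good_approximant_of_degree_one`, `ApproximationDegreeGenerators.lean`, produces such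
`f₀` when `K(x)^h = K(y)^h`; §12–14 produce them for trace combinations), and `x` is separable
over `K(y)^h`, then `x ∈ K(y)^h`. Ingredients: Lemma 7.2 (`approximationDegree_congr`: every
better approximant has the same constant `β`), Lemma 10.1 (density, `Kuhlmann2019Lemma41.lean`),
Lemma 10.4 with `𝐡 = 1` (`exists_mem_valuation_sub_mul_eq_of_dominant`,
`NewtonStepDominant.lean`), and Kuhlmann 2019, Thm. 2.3 (`KrasnerHenselian.lean`) in place of
Krasner's lemma with the bound `α`.

## Content (PROVED; no definitions, no named facts)

* `mem_henselization_of_degree_one` — **Prop. 10.5 / Cor. 10.8 "⇐" with `𝐡 = 1`**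
  [cite: KuhlmannVlahu2014, Prop. 10.5].

## Sources

* F.-V. Kuhlmann, I. Vlahu, Math. Z. 276 (2014) = arXiv:1304.0200: Lemma 7.2, Lemma 10.1,
  Lemma 10.3, Lemma 10.4, Prop. 10.5, Cor. 10.8 (pp. 16–21). [KuhlmannVlahu2014]
* F.-V. Kuhlmann, Israel J. Math. 234 (2019) = arXiv:1701.05508: Thm. 2.3. [Kuhlmann2019]

## Rendering notes

As in `ApproximationDegree.lean` / `ApproximationDegreeGenerators.lean`.
-/

noncomputable section

open Polynomial Finset IsLocalRing

namespace Literature.AlgebraicGeometry.Resolution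

universe u

variable {Ω : Type u} [Field Ω] [IsAlgClosed Ω] (V : ValuationSubring Ω) (K : Subfield Ω)

/-- **Kuhlmann–Vlahu 2014, Prop. 10.5 (with Cor. 10.8 "⇐") in relative approximation degree `1`,
separable case.** Let `K ≤ Ω` (inside the algebraically closed `(Ω, V)`), `x` transcendental over
`K` with `(K(x)|K, V)` immediate, of rank one and of transcendental approximation type, and
`y ∈ K(x)^h` transcendental over `K` with `(K(y)|K, V)` immediate, such that `𝐡_K(x:y) = 1` in the
concrete sense: some polynomial `f₀` over `K` has `f₀(x)` STRICTLY closer to `y` than every element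
of `K` and `|f₀(x) − f₀(c)| = β |x − c|` for `c ∈ K` close to `x` (`β ≠ 0`). If `x` is separable
over `L = K(y)^h`, then `x ∈ K(y)^h` — so `K(x)^h = K(y)^h`. Printed proof (Prop. 10.5): choose
`f` with `v(y − f(x)) ≥ dist(y,K)` and `> β_K(x:y) + 𝐡α`, apply Lemma 10.4 and Krasner's lemma;
here, for `𝐡 = 1`, Lemma 10.4 (`exists_mem_valuation_sub_mul_eq_of_dominant`) yields elements of
`L` ARBITRARILY close to `x` (`β_K(x:y) = β` does not depend on the approximant, Lemma 7.2 /
Lemma 10.3), and `x ∈ L` by Kuhlmann 2019, Thm. 2.3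
(`mem_of_isHenselianField_of_forall_exists_valuation_sub_lt`). PROVED.
[cite: KuhlmannVlahu2014, Prop. 10.5] -/
theorem mem_henselization_of_degree_one {x y : Ω}
    (htrans : ∀ P : Polynomial Ω, (∀ k, P.coeff k ∈ K) → P.eval x = 0 → P = 0)
    (himm : IsImmediateOver V K (Subfield.closure ((K : Set Ω) ∪ {x})))
    (h3 : ∀ g : Polynomial Ω, (∀ k, g.coeff k ∈ K) → ∃ a₀ ∈ K, ∃ α : V.ValueGroup,
      ∀ a ∈ K, V.valuation (x - a) ≤ V.valuation (x - a₀) → V.valuation (g.eval a) = α)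
    (hr1 : IsRankOneValued V (Subfield.closure ((K : Set Ω) ∪ {x})))
    (htransy : ∀ P : Polynomial Ω, (∀ k, P.coeff k ∈ K) → P.eval y = 0 → P = 0)
    (himmy : IsImmediateOver V K (Subfield.closure ((K : Set Ω) ∪ {y})))
    (hyx : y ∈ henselization V (Subfield.closure ((K : Set Ω) ∪ {x})))
    {f₀ : Polynomial Ω} (hf₀ : ∀ k, f₀.coeff k ∈ K)
    (hgood₀ : ∀ b ∈ K, V.valuation (y - f₀.eval x) < V.valuation (y - b))
    {β : V.ValueGroup} (hβ : β ≠ 0) {a₀ : Ω} (ha₀K : a₀ ∈ K)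
    (hf₀β : ∀ c ∈ K, V.valuation (x - c) ≤ V.valuation (x - a₀) →
      V.valuation (f₀.eval x - f₀.eval c) = β * V.valuation (x - c) ^ 1)
    (hsep : IsSeparable (henselization V (Subfield.closure ((K : Set Ω) ∪ {y}))) x) :
    x ∈ henselization V (Subfield.closure ((K : Set Ω) ∪ {y})) := by
  classical
  set Kx : Subfield Ω := Subfield.closure ((K : Set Ω) ∪ {x}) with hKx
  set Ky : Subfield Ω := Subfield.closure ((K : Set Ω) ∪ {y}) with hKy
  set L : Subfield Ω := henselization V Ky with hLdef
  set Hx : Subfield Ω := henselization V Kx with hHxdef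
  have hKKx : K ≤ Kx := fun c hc => Subfield.subset_closure (Or.inl hc)
  have hKKy : K ≤ Ky := fun c hc => Subfield.subset_closure (Or.inl hc)
  have hxKx : x ∈ Kx := Subfield.subset_closure (Or.inr rfl)
  have hyKy : y ∈ Ky := Subfield.subset_closure (Or.inr rfl)
  have hKyL : Ky ≤ L := le_henselization V Ky
  have hKL : K ≤ L := hKKy.trans hKyL
  have hyL : y ∈ L := hKyL hyKy
  have hKxHx : Kx ≤ Hx := le_henselization V Kx
  have hL : IsHenselianField L (V.comap (algebraMap L Ω)) :=
    Kuhlmann2010HenselizationIsHenselian_holds Ω V Ky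
  have himmL : IsImmediateOver V K L := himmy.trans (Kuhlmann2010HenselizationImmediate_holds Ω V Ky)
  have himmHx : IsImmediateOver V K Hx := himm.trans (Kuhlmann2010HenselizationImmediate_holds Ω V Kx)
  have hxK : x ∉ K := not_mem_of_forall_eval_eq_zero K htrans
  have hyK : y ∉ K := not_mem_of_forall_eval_eq_zero K htransy
  -- immediateness data
  have hval : ∀ w ∈ Kx, w ≠ 0 → ∃ b ∈ K, V.valuation w = V.valuation b := himm.1
  have hvaly : ∀ w ∈ Ky, w ≠ 0 → ∃ b ∈ K, V.valuation w = V.valuation b := himmy.1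
  have hres : ∀ w ∈ Kx, w ∈ V → ∃ c ∈ K, V.valuation (w - c) < 1 := by
    intro w hw hwV
    have hrw : residue V ⟨w, hwV⟩ ∈ resField V K := himm.2 (residue_mem_resField V ⟨w, hwV⟩ hw)
    obtain ⟨c, hcK, hcw⟩ := (mem_resField_iff V K _).mp hrw
    refine ⟨c, hcK, ?_⟩
    have h0 : residue V (⟨w, hwV⟩ - c) = 0 := by rw [map_sub, hcw, sub_self]
    exact (ValuationSubring.valuation_lt_one_iff V (⟨w, hwV⟩ - c)).mp ((residue_eq_zero_iff _).mp h0)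
  have hresy : ∀ w ∈ Ky, w ∈ V → ∃ c ∈ K, V.valuation (w - c) < 1 := by
    intro w hw hwV
    have hrw : residue V ⟨w, hwV⟩ ∈ resField V K := himmy.2 (residue_mem_resField V ⟨w, hwV⟩ hw)
    obtain ⟨c, hcK, hcw⟩ := (mem_resField_iff V K _).mp hrw
    refine ⟨c, hcK, ?_⟩
    have h0 : residue V (⟨w, hwV⟩ - c) = 0 := by rw [map_sub, hcw, sub_self]
    exact (ValuationSubring.valuation_lt_one_iff V (⟨w, hwV⟩ - c)).mp ((residue_eq_zero_iff _).mp h0)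
  have hxc0 : ∀ c ∈ K, V.valuation (x - c) ≠ 0 := fun c hc =>
    (_root_.map_ne_zero _).mpr fun h0 => hxK (by rw [sub_eq_zero.mp h0]; exact hc)
  ---------------------------------------------------------------- `d ∈ K` with `|d| = β`
  have hdeg₀ : 0 < f₀.natDegree := by
    by_contra h0
    obtain ⟨c₀, hc₀⟩ := natDegree_eq_zero.mp (Nat.eq_zero_of_not_pos h0)
    have hc₀K : c₀ ∈ K := by have := hf₀ 0; rwa [← hc₀, coeff_C_zero] at this
    have h := hgood₀ c₀ hc₀K
    rw [← hc₀, eval_C] at h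
    exact lt_irrefl _ h
  obtain ⟨k₀, -, -, β₀, hβ₀, a₁, ha₁K, hdat₀⟩ :=
    exists_approximationDegree V K hxK hval hres h3 hf₀ hdeg₀
  obtain ⟨a₂, ha₂K, ha₂⟩ : ∃ a₂ ∈ K, V.valuation (x - a₂) ≤ V.valuation (x - a₀) ∧
      V.valuation (x - a₂) ≤ V.valuation (x - a₁) := by
    rcases le_total (V.valuation (x - a₀)) (V.valuation (x - a₁)) with h | h
    · exact ⟨a₀, ha₀K, le_rfl, h⟩
    · exact ⟨a₁, ha₁K, h, le_rfl⟩
  have huniq₀ := approximationDegree_unique V K hxK hval hres ha₂K hβ hβ₀ (k := 1) (k' := k₀)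
    (fun c hc hle => by rw [← hf₀β c hc (hle.trans ha₂.1), (hdat₀ c hc (hle.trans ha₂.2)).2.2])
  obtain ⟨hk₀, hββ₀⟩ := huniq₀
  set d : Ω := (hasseDeriv 1 f₀).eval a₁ with hd
  have hdK : d ∈ K := eval_mem_subfield_of_coeff_mem (coeff_hasseDeriv_mem K hf₀ 1) ha₁K
  have hvd : V.valuation d = β := by
    have h := (hdat₀ a₁ ha₁K le_rfl).1
    rw [← hk₀] at h
    rw [hd, h, hββ₀]
  have hd0 : d ≠ 0 := fun h0 => hβ (by rw [← hvd, h0, map_zero])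
  ---------------------------------------------------------------- the approximation argument
  refine mem_of_isHenselianField_of_forall_exists_valuation_sub_lt V hL hsep fun e heL he0 => ?_
  -- `e₁ ∈ K` with `|e₁| = |e|`
  obtain ⟨e₁, he₁K, he₁⟩ := himmL.1 e heL he0
  have he₁0 : e₁ ≠ 0 := by
    rintro rfl
    rw [map_zero, map_eq_zero] at he₁
    exact he0 he₁
  -- the core: a good `f` with `|y - f(x)| < |d e₁|` gives `ℓ ∈ L` with `|x - ℓ| < |e|`
  have core : ∀ f : Polynomial Ω, (∀ k, f.coeff k ∈ K) →
      (∀ b ∈ K, V.valuation (y - f.eval x) ≤ V.valuation (y - b)) →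
      (∀ b ∈ K, V.valuation (f₀.eval x - f.eval x) ≤ V.valuation (f₀.eval x - b)) →
      V.valuation (y - f.eval x) < V.valuation (d * e₁) →
      ∃ ℓ ∈ L, V.valuation (x - ℓ) < V.valuation e := by
    intro f hf hgood hclose hsmall
    -- `f` is non-constant
    have hdegf : 0 < f.natDegree := by
      by_contra h0
      obtain ⟨c₀, hc₀⟩ := natDegree_eq_zero.mp (Nat.eq_zero_of_not_pos h0)
      have hc₀K : c₀ ∈ K := by have := hf 0; rwa [← hc₀, coeff_C_zero] at this
      obtain ⟨b, hbK, hb⟩ := exists_valuation_sub_lt V K hyK hvaly hresy hc₀K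
      have h1 := hgood b hbK
      rw [← hc₀, eval_C] at h1
      exact absurd hb (not_lt.mpr h1)
    -- Lemma 7.2: `|f(x) - f(c)| = β |x - c|` near `x`
    obtain ⟨a₃, ha₃K, hfβ⟩ := approximationDegree_congr V K hxK hval hres h3 hf₀ hf hclose hβ
      one_ne_zero ha₀K hf₀β
    -- the data of `f` itself, and uniqueness: degree `1`, constant `β`
    obtain ⟨kf, hkf1, -, βf, hβf, af, hafK, hdatf⟩ :=
      exists_approximationDegree V K hxK hval hres h3 hf hdegf
    obtain ⟨a₄, ha₄K, ha₄⟩ : ∃ a₄ ∈ K, V.valuation (x - a₄) ≤ V.valuation (x - a₃) ∧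
        V.valuation (x - a₄) ≤ V.valuation (x - af) := by
      rcases le_total (V.valuation (x - a₃)) (V.valuation (x - af)) with h | h
      · exact ⟨a₃, ha₃K, le_rfl, h⟩
      · exact ⟨af, hafK, h, le_rfl⟩
    obtain ⟨hk, hβf'⟩ := approximationDegree_unique V K hxK hval hres ha₄K hβ hβf (k := 1) (k' := kf)
      (fun c hc hle => by rw [← hfβ c hc (hle.trans ha₄.1), (hdatf c hc (hle.trans ha₄.2)).2.2])
    -- centre `a₄`, scale `b ∈ K` with `|b| = |x - a₄|`
    have hxa₄ : x - a₄ ≠ 0 := fun h0 => hxK (by rw [sub_eq_zero.mp h0]; exact ha₄K)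
    obtain ⟨b, hbK, hvb⟩ := hval (x - a₄) (sub_mem hxKx (hKKx ha₄K)) hxa₄
    have hb0 : b ≠ 0 := by
      rintro rfl
      rw [map_zero, map_eq_zero] at hvb
      exact hxa₄ hvb
    have hvb' : V.valuation b = V.valuation (x - a₄) := hvb.symm
    -- the linear Taylor term and the dominance at `a₄`
    have hdat₄ := hdatf a₄ ha₄K ha₄.2
    rw [← hk, ← hβf'] at hdat₄
    have ht1 : V.valuation ((taylor a₄ f).coeff 1 * b ^ 1) = β * V.valuation (x - a₄) := by
      rw [taylor_coeff, map_mul, hdat₄.1, map_pow, pow_one, hvb']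
    have hpos : 0 < β * V.valuation (x - a₄) :=
      mul_pos (zero_lt_iff.mpr hβ) (zero_lt_iff.mpr (hxc0 a₄ ha₄K))
    have ht10 : (taylor a₄ f).coeff 1 * b ^ 1 ≠ 0 := fun h0 => by
      rw [h0, map_zero] at ht1
      exact hpos.ne' ht1.symm |>.elim
    have hdom : ∀ i, 2 ≤ i → i ≤ f.natDegree →
        V.valuation ((taylor a₄ f).coeff i * b ^ i) < V.valuation ((taylor a₄ f).coeff 1 * b ^ 1) := by
      intro i hi _
      have h := hdat₄.2.1 i (by omega) (by omega)
      rw [map_mul, map_pow, pow_one] at h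
      rw [taylor_coeff, map_mul, map_pow, hvb', ht1]
      exact h
    -- `|f(x) - y| < |t₁|`
    have hfy : V.valuation (f.eval x - y) < V.valuation ((taylor a₄ f).coeff 1 * b ^ 1) := by
      have h := (valuation_sub_eval_lt_of_good V K hxK hval hres hyK hvaly hresy hf hgood hβ
        one_ne_zero (a₀ := a₃) hfβ ha₄K ha₄.1).1
      rw [hfβ a₄ ha₄K ha₄.1, pow_one] at h
      rw [Valuation.map_sub_swap, ht1]
      exact h
    -- the Newton step
    obtain ⟨ℓ, hℓL, hℓ⟩ :=
      exists_mem_valuation_sub_mul_eq_of_dominant V K hL hKL ha₄K hbK hb0 hvb' hf ht10 hdom hyL hfy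
    refine ⟨ℓ, hℓL, ?_⟩
    rw [ht1, hvb'] at hℓ
    have hlt : V.valuation (x - ℓ) * (β * V.valuation (x - a₄)) <
        V.valuation e * (β * V.valuation (x - a₄)) := by
      rw [hℓ]
      calc V.valuation (x - a₄) * V.valuation (f.eval x - y)
          < V.valuation (x - a₄) * V.valuation (d * e₁) := by
            refine mul_lt_mul_of_pos_left ?_ (zero_lt_iff.mpr (hxc0 a₄ ha₄K))
            rw [Valuation.map_sub_swap]; exact hsmall
        _ = V.valuation e * (β * V.valuation (x - a₄)) := by rw [map_mul, hvd, ← he₁]; ac_rfl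
    exact lt_of_mul_lt_mul_right hlt hpos.le
  ---------------------------------------------------------------- the choice of `f`
  by_cases hyf₀ : y = f₀.eval x
  · refine core f₀ hf₀ (fun b hb => (hgood₀ b hb).le) (fun b hb => ?_) ?_
    · rw [sub_self, map_zero]; exact zero_le
    · rw [hyf₀, sub_self, map_zero]
      exact (Valuation.pos_iff _).mpr (mul_ne_zero hd0 he₁0)
  · -- `e₂ ∈ K` with `|e₂| = |y - f₀(x)|`
    have hf₀x : f₀.eval x ∈ Kx := eval_mem_subfield_of_coeff_mem (fun k => hKKx (hf₀ k)) hxKx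
    have hyf₀Hx : y - f₀.eval x ∈ Hx := sub_mem hyx (hKxHx hf₀x)
    obtain ⟨e₂, he₂K, he₂⟩ := himmHx.1 _ hyf₀Hx (sub_ne_zero.mpr hyf₀)
    have he₂0 : e₂ ≠ 0 := by
      rintro rfl
      rw [map_zero, map_eq_zero, sub_eq_zero] at he₂
      exact hyf₀ he₂
    -- threshold `c₀ ∈ K^×` below both `|d e₁|` and `|e₂|`
    obtain ⟨c₀, hc₀K, hc₀0, hc₀1, hc₀2⟩ : ∃ c₀ ∈ K, c₀ ≠ 0 ∧
        V.valuation c₀ ≤ V.valuation (d * e₁) ∧ V.valuation c₀ ≤ V.valuation e₂ := by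
      rcases le_total (V.valuation (d * e₁)) (V.valuation e₂) with h | h
      · exact ⟨d * e₁, K.mul_mem hdK he₁K, mul_ne_zero hd0 he₁0, le_rfl, h⟩
      · exact ⟨e₂, he₂K, he₂0, h, le_rfl⟩
    obtain ⟨f, hf, hfy⟩ := exists_polynomial_valuation_sub_lt_of_mem_henselization V K hxK hval
      hres h3 hr1 hyx (hKKx hc₀K) hc₀0
    have hlt₂ : V.valuation (y - f.eval x) < V.valuation (y - f₀.eval x) := by
      rw [he₂]; exact lt_of_lt_of_le hfy hc₀2
    have hgood : ∀ b ∈ K, V.valuation (y - f.eval x) ≤ V.valuation (y - b) := fun b hb =>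
      (hlt₂.trans (hgood₀ b hb)).le
    have hclose : ∀ b ∈ K, V.valuation (f₀.eval x - f.eval x) ≤ V.valuation (f₀.eval x - b) := by
      intro b hb
      have h1 : V.valuation (f₀.eval x - f.eval x) = V.valuation (y - f₀.eval x) := by
        have hid : f₀.eval x - f.eval x = (y - f.eval x) - (y - f₀.eval x) := by ring
        rw [hid, Valuation.map_sub_eq_of_lt_right _ hlt₂]
      have h2 : V.valuation (f₀.eval x - b) = V.valuation (y - b) := by
        have hid : f₀.eval x - b = (y - b) - (y - f₀.eval x) := by ring
        rw [hid, Valuation.map_sub_eq_of_lt_left _ (hgood₀ b hb)]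
      rw [h1, h2]
      exact (hgood₀ b hb).le
    exact core f hf hgood hclose (lt_of_lt_of_le hfy hc₀1)

end Literature.AlgebraicGeometry.Resolution
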